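import Mathlib
import HarnessLib
import Literature.Analysis.FluidPDE.ClassicalSolution
import Literature.Analysis.FluidPDE.SelfSimilar
import Literature.Analysis.FluidPDE.TypeIAncientMild
import Summits.NavierStokesRegularity.NavierStokesRegularity.Theorems.QuarterLogPincerThinCascadeDefs

/-!
# Route `QuarterLogPincer` — objects posited by the EDGE LINE `truncation_edge` of crux `TypeIQuantSubcubicExp`
  (item stmt-NavierStokesRegularity-24077): the fixed-constant crux instance, truncated families, and the three
  obligations T1 (far-field truncation), T3 (envelope cube budget), T4 (Leray rate floor)

Definitions ONLY — the line objects of `Cruxes/TypeIQuantSubcubicExp/Lines/truncation_edge.lean` (author of every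
statement: **ns-idea-7 g8**; version of record v1.1 `dca6249ee423`, critics idea-crit-4 PASS 18:45:39Z / idea-crit-7
backstop 18:47:24Z, 2026-08-28), copied VERBATIM and only re-homed into an importable module (crux workfiles under
`Cruxes/` are not importable from `Theorems/`), so that the obligations can be proved BY NAME with their line signatures in
separate Theorems files — exactly as `QuarterLogPincerThinCascadeDefs` / `QuarterLogPincerAnalyticWindowDefs` serve the
lines `thin_cascade` / `analytic_window`.  Same namespace as the line (`…Cruxes.TypeIQuantSubcubicExp.TruncationEdge`), same
names, same bodies.  Landed by nsreg-C26-p1 g7 on DIRECTOR-NS #259 (2), `--supports stmt-NavierStokesRegularity-24077`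
(helper).  The line's THEOREMS (arithmetic core `not_quantSubcubicExpAt_of_truncatedFamily`, `truncatedFamily_of_parts`,
the edge `envelopeLiouville_of_typeIQuantSubcubicExp` and its by-name corollaries) are NOT in this file (they import the
route file and four Theorems modules; a transfer module is the author's / LEAD's call).

* `QuantSubcubicExpAt M` — the body of the crux `QuarterLogPincer.TypeIQuantSubcubicExp` at the Type-I constant `M`
  (so that the crux is `∀ M, QuantSubcubicExpAt M` definitionally);
* `TruncatedFamily M' K₁ K₂ c ε₀` — Tao-frame solutions on `[0, 1−ε]`, `ε ≤ ε₀`, with the virtual Type-I bound of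
  constant `M'`, cube-log `L³` budget `A³ ≤ K₁ + K₂ log(1/ε)` and a final value `≥ c/√ε`;
* `FarFieldTruncation M v` (T1, THE INPUT), `EnvelopeCubeBudget v` (T3), `RateFloor v` (T4), and their closed forms
  `StubFarFieldTruncation`, `StubEnvelopeCubeBudget`, `StubRateFloor`.

HONEST FRAME: an EDGE (calibration) line — it places the crux (24077 ⇒ the envelope-class Liouville wall 22144 modulo
T1/T3/T4), it does not attack it; 24077, 22144, the DSS wall W7 and Navier–Stokes regularity are OPEN / not proved.
Nothing in this file is asserted: objects only.
-/

noncomputable section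

-- the summit-side namespace repeats a component by design (D-0017)
set_option linter.dupNamespace false

namespace Summit.NavierStokesRegularity.NavierStokesRegularity.Cruxes.TypeIQuantSubcubicExp.TruncationEdge

open MeasureTheory Set Function Metric Filter Topology
open scoped ENNReal NNReal
open Literature.Analysis Literature.Analysis.FluidPDE
open Summit.NavierStokesRegularity.NavierStokesRegularity.Cruxes.TypeIQuantSubcubicExp.ThinCascade
  (TaoFrame SingularAt)

/-! ### Objects (verbatim from `Lines/truncation_edge.lean` v1.1) -/

/-! ### The crux at a fixed Type-I constant -/

/-- The statement of the crux `TypeIQuantSubcubicExp` AT the Type-I constant `M` (its body, verbatim).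
[line object of `Cruxes/TypeIQuantSubcubicExp/Lines/truncation_edge.lean` (ns-idea-7 g8), verbatim] -/
def QuantSubcubicExpAt (M : ℝ) : Prop :=
  ∃ F : ℝ → ℝ, (∀ ε : ℝ, 0 < ε → ∃ A₀ : ℝ, ∀ A : ℝ, A₀ ≤ A → F A ≤ Real.exp (ε * A ^ 3)) ∧
    ∀ (T τ A : ℝ) (u : ℝ → EuclideanSpace ℝ (Fin 3) → EuclideanSpace ℝ (Fin 3))
      (p : ℝ → EuclideanSpace ℝ (Fin 3) → ℝ),
      (IsClassicalNSSolutionOn (Set.Icc 0 T) 1 0 u p ∧ ∀ n : ℕ, ∃ C : NNReal, ∀ t ∈ Set.Icc 0 T,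
          eLpNorm (iteratedFDeriv ℝ n (u t)) 2 volume ≤ C) → 0 < τ →
      (∀ t ∈ Set.Icc 0 T, ∀ x : EuclideanSpace ℝ (Fin 3),
          ‖u t x‖ ≤ M * (T + τ - t) ^ (-(1 / 2 : ℝ))) →
      (∀ t ∈ Set.Icc 0 T, eLpNorm (u t) 3 volume ≤ ENNReal.ofReal A) → 2 ≤ A →
      ∀ t ∈ Set.Ioc 0 T, ∀ x : EuclideanSpace ℝ (Fin 3), ‖u t x‖ ≤ F A * t ^ (-(1 / 2 : ℝ))

/-! ### The truncated family -/

/-- A **TRUNCATED FAMILY** at Type-I constant `M'`, cube-log budget `(K₁, K₂)`, floor `c`, depth `ε₀`: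
for every `ε ∈ (0, ε₀]` a Tao-frame solution on `[0, 1−ε]` with the virtual Type-I bound of constant
`M'` and virtual blow-up time `1`, an `L³` bound `A ≥ 2` with `A³ ≤ K₁ + K₂ log(1/ε)`, and a
final-time value `‖u(1−ε, x)‖ ≥ c/√ε`. [line object of `Cruxes/TypeIQuantSubcubicExp/Lines/truncation_edge.lean` (ns-idea-7 g8), verbatim] -/
def TruncatedFamily (M' K₁ K₂ c ε₀ : ℝ) : Prop :=
  ∀ ε ∈ Set.Ioc (0 : ℝ) ε₀,
    ∃ (A : ℝ) (u : ℝ → EuclideanSpace ℝ (Fin 3) → EuclideanSpace ℝ (Fin 3))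
      (p : ℝ → EuclideanSpace ℝ (Fin 3) → ℝ),
      TaoFrame (1 - ε) u p ∧
      (∀ t ∈ Set.Icc 0 (1 - ε), ∀ x : EuclideanSpace ℝ (Fin 3),
          ‖u t x‖ ≤ M' * (1 - ε + ε - t) ^ (-(1 / 2 : ℝ))) ∧
      (∀ t ∈ Set.Icc 0 (1 - ε), eLpNorm (u t) 3 volume ≤ ENNReal.ofReal A) ∧
      2 ≤ A ∧ A ^ 3 ≤ K₁ + K₂ * Real.log (1 / ε) ∧
      ∃ x : EuclideanSpace ℝ (Fin 3), c / Real.sqrt ε ≤ ‖u (1 - ε) x‖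

/-! ### The three obligations (statements) -/

/-- (T1) **FINITE-TIME FAR-FIELD TRUNCATION STABILITY** for the enveloped Type-I ancient mild field `v`
(rate `M`, envelope `A`): for every accuracy `δ ∈ (0,1]` there are `κ ≥ 0`, `K ≥ 1` such that for every
`ε ∈ (0, 1/2]` some radius `2 ≤ R ≤ K ε^{−κ}` and some Tao-frame solution `(u, p)` on `[0, 1−ε]`
(think: issued from the Bogovskiĭ-corrected cut-off of `v(−1)` at radius `R`, shifted in time by `1`)
satisfy: the virtual Type-I bound with constant `M+1` and virtual blow-up time `1`; the `L³` norm of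
`u(t)` exceeds any common bound `b` of the `B(R)`-localised slices `v(s)`, `s ∈ [−1,−ε]`, by at most an
excess `k ≥ 0` with `k³ ≤ K·(1 + log R + log(1/ε))` (v1.1: log-shaped, not `ε`/`R`-uniform); and
`‖u(1−ε, x) − v(−ε, x)‖ ≤ δ` on the unit ball.  THE INPUT of the line. [line object of `Cruxes/TypeIQuantSubcubicExp/Lines/truncation_edge.lean` (ns-idea-7 g8), verbatim] -/
def FarFieldTruncation (M : ℝ) (v : ℝ → EuclideanSpace ℝ (Fin 3) → EuclideanSpace ℝ (Fin 3)) : Prop :=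
  ∀ δ : ℝ, 0 < δ → δ ≤ 1 → ∃ κ K : ℝ, 0 ≤ κ ∧ 1 ≤ K ∧ ∀ ε ∈ Set.Ioc (0 : ℝ) (1 / 2),
    ∃ (R : ℝ) (u : ℝ → EuclideanSpace ℝ (Fin 3) → EuclideanSpace ℝ (Fin 3))
      (p : ℝ → EuclideanSpace ℝ (Fin 3) → ℝ),
      2 ≤ R ∧ R ≤ K * ε ^ (-κ) ∧ TaoFrame (1 - ε) u p ∧
      (∀ t ∈ Set.Icc 0 (1 - ε), ∀ x : EuclideanSpace ℝ (Fin 3),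
          ‖u t x‖ ≤ (M + 1) * (1 - ε + ε - t) ^ (-(1 / 2 : ℝ))) ∧
      (∃ k : ℝ, 0 ≤ k ∧ k ^ 3 ≤ K * (1 + Real.log R + Real.log (1 / ε)) ∧
        ∀ b : ℝ, 0 ≤ b →
          (∀ s ∈ Set.Icc (-1 : ℝ) (-ε),
              eLpNorm ((Metric.ball (0 : EuclideanSpace ℝ (Fin 3)) R).indicator (v s)) 3 volume ≤
                ENNReal.ofReal b) →
          ∀ t ∈ Set.Icc 0 (1 - ε), eLpNorm (u t) 3 volume ≤ ENNReal.ofReal (b + k)) ∧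
      (∀ x ∈ Metric.ball (0 : EuclideanSpace ℝ (Fin 3)) 1, ‖u (1 - ε) x - v (-ε) x‖ ≤ δ)

/-- (T3) **CUBE BUDGET OF THE ENVELOPE**: the localised `L³` norm of the slices of `v` on `B(R)`,
`R ≥ 2`, over `s ∈ [−1, −ε]`, is bounded by `b` with `b³ ≤ B·(1 + log R + log(1/ε))`
(`∫_{B(R)} (A/(|x|+√(−s)))³ dx ≤ 4πA³(1/3 + log(R/√(−s)))`; Barker–Prange 2021 Cor. 1's upper bound). [line object of `Cruxes/TypeIQuantSubcubicExp/Lines/truncation_edge.lean` (ns-idea-7 g8), verbatim] -/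
def EnvelopeCubeBudget (v : ℝ → EuclideanSpace ℝ (Fin 3) → EuclideanSpace ℝ (Fin 3)) : Prop :=
  ∃ B : ℝ, 0 ≤ B ∧ ∀ R : ℝ, 2 ≤ R → ∀ ε ∈ Set.Ioc (0 : ℝ) 1, ∃ b : ℝ, 0 ≤ b ∧
    b ^ 3 ≤ B * (1 + Real.log R + Real.log (1 / ε)) ∧
    ∀ s ∈ Set.Icc (-1 : ℝ) (-ε),
      eLpNorm ((Metric.ball (0 : EuclideanSpace ℝ (Fin 3)) R).indicator (v s)) 3 volume ≤
        ENNReal.ofReal b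

/-- (T4) **LERAY FLOOR AT THE SINGULAR APEX** (Leray 1934 §19 (3.9); KNSS gauge): some `c > 0` with
`sup_x ‖v(s,x)‖ ≥ c/√(−s)` attained at a point, for every `s ∈ [−1, 0)`. [line object of `Cruxes/TypeIQuantSubcubicExp/Lines/truncation_edge.lean` (ns-idea-7 g8), verbatim] -/
def RateFloor (v : ℝ → EuclideanSpace ℝ (Fin 3) → EuclideanSpace ℝ (Fin 3)) : Prop :=
  ∃ c : ℝ, 0 < c ∧ ∀ s ∈ Set.Ico (-1 : ℝ) 0, ∃ x : EuclideanSpace ℝ (Fin 3),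
    c / Real.sqrt (-s) ≤ ‖v s x‖

/-- Registered form of T1 (closed statement). [line object of `Cruxes/TypeIQuantSubcubicExp/Lines/truncation_edge.lean` (ns-idea-7 g8), verbatim] -/
def StubFarFieldTruncation : Prop :=
  ∀ (M A : ℝ) (v : ℝ → EuclideanSpace ℝ (Fin 3) → EuclideanSpace ℝ (Fin 3)),
    IsTypeIAncientMild M v → HasTypeIDecay A v → FarFieldTruncation M v

/-- Registered form of T3 (closed statement). [line object of `Cruxes/TypeIQuantSubcubicExp/Lines/truncation_edge.lean` (ns-idea-7 g8), verbatim] -/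
def StubEnvelopeCubeBudget : Prop :=
  ∀ (A : ℝ) (v : ℝ → EuclideanSpace ℝ (Fin 3) → EuclideanSpace ℝ (Fin 3)),
    0 ≤ A → HasTypeIDecay A v → EnvelopeCubeBudget v

/-- Registered form of T4 (closed statement). [line object of `Cruxes/TypeIQuantSubcubicExp/Lines/truncation_edge.lean` (ns-idea-7 g8), verbatim] -/
def StubRateFloor : Prop :=
  ∀ (M : ℝ) (v : ℝ → EuclideanSpace ℝ (Fin 3) → EuclideanSpace ℝ (Fin 3)),
    IsTypeIAncientMild M v → SingularAt v 0 → RateFloor v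

end Summit.NavierStokesRegularity.NavierStokesRegularity.Cruxes.TypeIQuantSubcubicExp.TruncationEdge

end
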